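import Summits.ABC.IUTFork.Joshi.InitialThetaDataJoshi
import Summits.ABC.IUTFork.Joshi.ThetaJoshiConstruction
import HarnessLib

/-!
# [J-III] Thm. 6.1.1 over the REAL valuation sets: the merge-debt `ModuliDescentDatum.sel` = `InitialThetaData.underline`

Record file (D-0012) of the abc-iut cell, block E «type Joshi's construction, test vs S» (rung LADDER-ABC:A2.E; seat
abc-iut-E-t6, slot T-06; merge-debt reconciliation E-t6 ↔ E-t10 of `HOME/plan/E/ASSIGNMENTS.md` §3). TAKES NO SIDE on
[IUTchIII] Cor. 3.12, on the claims of K. Joshi (arXiv:2401.13508v4 = [J-III], unrefereed), or on S. Mochizuki's reports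
on them; typed ≠ proved; typed AS A CANDIDATE ≠ endorsed.

E-t10's `Joshi/ThetaJoshiConstruction.lean` (p428539) types [J-III] Thm. 6.1.1 («descent of holomorphoid data to
`L_mod`», p.43) over an INTERIM abstract carrier `ATS3.ModuliDescentDatum` whose fields `VL'`, `Vmod`, `LiesOver`,
`sel`, `sel_liesOver`, `sel_injective` abstract the valuation sets `V_{L'}`, `V_{L_mod}`, the relation `w | v` and the
fixed bijection `V_{L_mod} ≃ V ⊂ V_{L'}` of [J-III] §3.3 (14). E-t6's `Joshi/InitialThetaDataJoshi.lean` (p428841) types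
(14) over the REAL carriers: `V : Set (Val L')` with `Set.BijOn (toVMod L L' C) V univ` (the tree's restriction of
places `Val L' → Val L → Val L_mod`, `L_mod = fieldOfModuli C = ℚ(j_C)`), inverse bijection `InitialThetaData.underline`.
This file DISCHARGES the merge-debt: `InitialThetaData.toModuliDescentDatum` instantiates E-t10's carrier with
`VL' := Val L'`, `Vmod := Val L_mod`, `LiesOver w v := toVMod w = v`, `sel := D.underline` — the remaining abstract inputs
being exactly the Fargues–Fontaine data (`|Y_{C_p^♭,L'_w}|`, `|Y_{C_p^♭,L_mod,v}|`, `f_{w|v}` of [FF18] Prop. 2.3.20; slots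
T-09 / E-t3's `PeriodRingDatum`) — and records that the chosen section IS `V` (`range_sel_eq_V`) and how Thm. 6.1.1's
construction `descend` then reads (`descend_toModuliDescentDatum`). `L`, `L'` in `Type` (E-t10's carrier has
`VL' Vmod : Type`). Nothing of [J-III] is asserted. [claim: Joshi2024ATS3, status: disputed]
-/

noncomputable section

open scoped Classical
open NumberField
open Literature.IUT.HodgeTheaters hiding InitialThetaData

universe w

namespace Summit.ABC.IUTFork.Joshi.ATS3.InitialThetaData

variable {L L' : Type} {Lbar : Type w} [Field L] [NumberField L] [Field L'] [NumberField L'] [Algebra L L']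
  [Field Lbar] [Algebra L Lbar] [Algebra L' Lbar] {C : WeierstrassCurve L} [C.IsElliptic] {ℓ : ℕ}
  (D : InitialThetaData L L' Lbar C ℓ)

/-- The image of `v ↦ v̲` is exactly the chosen set `V` of (14). PROVED. [folklore] -/
theorem range_underline_eq_V : Set.range D.underline = D.V := by
  ext w
  constructor
  · rintro ⟨v, rfl⟩
    exact D.underline_mem v
  · intro hw
    exact ⟨toVMod L L' C w, D.underline_toVMod hw⟩

/-- **Merge-debt E-t6 ↔ E-t10 (ASSIGNMENTS §3): E-t10's `ATS3.ModuliDescentDatum` over the REAL valuation sets of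
Joshi's data.** `VL' := Val L'` (all places of `L'`), `Vmod := Val L_mod` (`L_mod = fieldOfModuli C`), `w | v :=
(toVMod L L' C w = v)`, `sel := v ↦ v̲` (the inverse of the bijection (14)), with its two laws PROVED
(`toVMod_underline`, injectivity of a section); the Fargues–Fontaine sorts `|Y_{C_p^♭,L'_w}|`, `|Y_{C_p^♭,L_mod,v}|` and the
maps `f_{w|v}` ([J-III] p.43 l.15–46, [FF18] Prop. 2.3.20) remain ARGUMENTS (slot T-09 / E-t3 carriers). A DEFINITION;
nothing asserted. [claim: Joshi2024ATS3, status: disputed] -/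
def toModuliDescentDatum (Y : Val L' → Type) (Ymod : Val (fieldOfModuli C) → Type)
    (proj : ∀ (w : Val L') (v : Val (fieldOfModuli C)), toVMod L L' C w = v → Y w → Ymod v) :
    ModuliDescentDatum where
  VL' := Val L'
  Vmod := Val (fieldOfModuli C)
  LiesOver w v := toVMod L L' C w = v
  sel := D.underline
  sel_liesOver := D.toVMod_underline
  sel_injective v v' h := by
    -- `v ↦ v̲` is a section of `toVMod`, hence injective
    have h' := congrArg (toVMod L L' C) h
    rwa [D.toVMod_underline, D.toVMod_underline] at h'
  Y := Y
  Ymod := Ymod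
  proj := proj

variable (Y : Val L' → Type) (Ymod : Val (fieldOfModuli C) → Type)
  (proj : ∀ (w : Val L') (v : Val (fieldOfModuli C)), toVMod L L' C w = v → Y w → Ymod v)

/-- The chosen section of the instantiated carrier is `v ↦ v̲`. [folklore] -/
theorem toModuliDescentDatum_sel (v : Val (fieldOfModuli C)) :
    (D.toModuliDescentDatum Y Ymod proj).sel v = D.underline v := rfl

/-- Its image is the set `V` of (14) («`V_{L_mod} ≃ V ⊂ V_{L'}`»). PROVED. [folklore] -/
theorem range_sel_eq_V : Set.range (D.toModuliDescentDatum Y Ymod proj).sel = D.V := D.range_underline_eq_V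

/-- **Thm. 6.1.1's construction over the real valuation sets**: E-t10's `ModuliDescentDatum.descend` (p.43 l.47–51,
«`y̲ = (f_{w|v}(y′_w))_{w ∈ V}`») on the instantiated carrier sends `y = (y′_w)_{w ∈ V(L')}` to the point of `𝒴_{L_mod}`
whose `v`-coordinate is `f_{v̲|v}(y′_{v̲})`. PROVED (by `rfl`). [claim: Joshi2024ATS3, status: disputed] -/
theorem descend_toModuliDescentDatum (y : (D.toModuliDescentDatum Y Ymod proj).Arith) (v : Val (fieldOfModuli C)) :
    (D.toModuliDescentDatum Y Ymod proj).descend y v = proj (D.underline v) v (D.toVMod_underline v) (y (D.underline v)) :=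
  rfl

/-- The descent reads only the coordinates of `y` on `V`: two points of `𝒴_{L'}` agreeing on `V` have the same `y̲`.
PROVED. [folklore] -/
theorem descend_eq_of_eqOn_V {y y' : (D.toModuliDescentDatum Y Ymod proj).Arith} (h : ∀ w ∈ D.V, y w = y' w) :
    (D.toModuliDescentDatum Y Ymod proj).descend y = (D.toModuliDescentDatum Y Ymod proj).descend y' := by
  funext v
  rw [descend_toModuliDescentDatum, descend_toModuliDescentDatum, h _ (D.underline_mem v)]

/-- E-t10's typed Thm. 6.1.1 (`ModuliDescentDatum.Thm611`) holds on the instantiated carrier (it is the construction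
`descend`; E-t10's `thm611_holds`). [claim: Joshi2024ATS3, status: disputed] -/
theorem thm611_toModuliDescentDatum : (D.toModuliDescentDatum Y Ymod proj).Thm611 :=
  (D.toModuliDescentDatum Y Ymod proj).thm611_holds

end Summit.ABC.IUTFork.Joshi.ATS3.InitialThetaData

end
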